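import Mathlib
import HarnessLib
import Summits.CriticalPhenomena.PercolationContinuityZ3.Theses.PercTreeValue
import Summits.CriticalPhenomena.PercolationContinuityZ3.Theses.PercAnnulusCrossing
import Summits.CriticalPhenomena.PercolationContinuityZ3.Theorems.PercTreeValueTetrahedronDisjointCoexistenceStubTiledShellAspect
import Summits.CriticalPhenomena.PercolationContinuityZ3.Theorems.PercTreeValueTetrahedronDisjointCoexistenceStubAnnulusWalls
import Summits.CriticalPhenomena.PercolationContinuityZ3.Theorems.PercTreeValueTetrahedronDisjointCoexistenceStubShellDecoupling
import Summits.CriticalPhenomena.PercolationContinuityZ3.Theorems.PinholeClosing.Negative.PinholeClosingResistance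
import Literature.Probability.Percolation.RSW

/-!
# `stub_annulusNonCrossing_of_aspectFour` of line `Sketch` (crux `TetrahedronDisjointCoexistence`,
# stmt-CriticalPhenomena-7798): the aspect ratio of X_B is immaterial

Registered link stub X4 (rev c3) of the lead's skeleton
`Cruxes/TetrahedronDisjointCoexistence/Lines/Sketch.lean`, landed DEF-FREE over tree declarations.

**Statement.** If, at `p_c(ℤ³)`, uniformly in `n ≥ 1`, the probability that some vertex of `B(n)` is
joined INSIDE `B(4n)` to the inner vertex boundary of `B(4n)` is `≤ 1 - c₄` (X_B at aspect `4`, the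
registered open stub `stub_annulusNonCrossingFour`), then the same holds at aspect `2` with another
constant, i.e. `PercAnnulusCrossing.CritAnnulusNonCrossing` (stmt-CriticalPhenomena-0846, "X_B")
verbatim. The converse is pointwise (a crossing of `B(4n) ∖ B(n)` crosses `B(2n) ∖ B(n)` after
clipping), so the two forms are EQUIVALENT; only the aspect-4 form is numerically visible
(`1 - P ≈ 1.7·10⁻³` flat in `n = 4…48` against `< 1.3·10⁻⁴` at aspect 2, Numerics-Sketch-c1.md).

**Proof.**
* `n ≥ 7`. Put `m = ⌊(n-2)/5⌋ ≥ 1` (so `5m + 2 ≤ n ≤ 5m + 6`), `g = 2m + 1`, and let `J` be the grid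
  `{g·j : j ∈ B(4)}` (`|J| ≤ 9³`). An X_B crossing at scale `n` contains, after its last exit from
  `B(n)`, an open path of the shell `B(2n) ∖ B(n)` from a neighbour `u` of `B(n)` to a vertex adjacent
  to `B(2n)ᶜ` (landed `annulusWalls_crossing`). Rounding `u` to the grid, `u ∈ v + B(m)` for some
  `v ∈ J`, and every lattice neighbour of `v + B(4m)` lies in `B(2n)` (`(n+1) + m + 4m + 1 ≤ 2n`). So the
  shell event `Shell(B(n), B(2n))` of the landed `stub_tiledShellAspect` (tiles `(m, 4m)`) is disjoint
  from the X_B event on lattice configurations, and `P(X_B(n)) ≤ 1 - P(Shell) ≤ 1 - c₄ ^ |J| ≤ 1 - c₄ ^ 9³`.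
* `1 ≤ n ≤ 6`. Finite energy: `P(no crossing) ≥ (1 - p_c)^{#edges touching B(n)} > 0` (landed
  `PinholeClosing.Negative.blockProb_pos` with budget `0`, `p_c < 1`), and a minimum over six values.
-/

noncomputable section

namespace Summit.CriticalPhenomena.PercolationContinuityZ3.Theorems.TetrahedronDisjointCoexistence

open MeasureTheory
open Literature.Probability.Percolation Literature.Probability.LatticeModels

/-! ### Bookkeeping -/

/-- Membership in a cube `Icc (-lo…) (hi…)` with constant corner functions, coordinatewise. -/
theorem annulusAspect_mem_Icc (lo hi : ℤ) (x : Site 3) :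
    x ∈ Set.Icc (fun _ : Fin 3 => lo) (fun _ : Fin 3 => hi) ↔ ∀ i, lo ≤ x i ∧ x i ≤ hi := by
  simp only [Set.mem_Icc, Pi.le_def, forall_and]

/-- The annulus-crossing event `A(n, M)` ("some vertex of `B(n)` is joined inside `B(M)` to `∂ⁱⁿB(M)`")
is measurable. -/
theorem annulusAspect_measurableSet_crossing (n M : ℕ) :
    MeasurableSet {ω : BondConfig (Site 3) | ∃ x ∈ box 3 n,
      ∃ y ∈ innerBoundary (zdGraph 3) (box 3 M), ω ∈ openConnIn ↑(box 3 M) x y} := by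
  have h : {ω : BondConfig (Site 3) | ∃ x ∈ box 3 n,
      ∃ y ∈ innerBoundary (zdGraph 3) (box 3 M), ω ∈ openConnIn ↑(box 3 M) x y} =
      ⋃ x ∈ box 3 n, ⋃ y ∈ innerBoundary (zdGraph 3) (box 3 M),
        (openConnIn (↑(box 3 M) : Set (Site 3)) x y : Set (BondConfig (Site 3))) := by
    ext ω
    simp only [Set.mem_setOf_eq, Set.mem_iUnion, exists_prop]
  rw [h]
  exact Finset.measurableSet_biUnion _ fun x _ =>
    Finset.measurableSet_biUnion _ fun y _ => restrictProduct_measurableSet_openConnIn _ x y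

/-- **Finite energy.** At `p_c(ℤ³)` every annulus is blocked with positive probability:
`P(A(n, 2n)) < 1` for `n ≥ 1` (all edges touching `B(n)` closed; landed
`PinholeClosing.Negative.blockProb_pos` with budget `0`). -/
theorem annulusAspect_real_crossing_lt_one (n : ℕ) (hn : 1 ≤ n) :
    (bondPercolation (zdGraph 3) (criticalProbI 3)).real {ω : BondConfig (Site 3) | ∃ x ∈ box 3 n,
      ∃ y ∈ innerBoundary (zdGraph 3) (box 3 (2 * n)), ω ∈ openConnIn ↑(box 3 (2 * n)) x y} < 1 := by
  have hpos := PinholeClosing.Negative.blockProb_pos (k := 0) (n := n) (m := 2 * n) (by omega)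
  have hsub : {ω : BondConfig (Site 3) | ∃ S : Finset (Sym2 (Site 3)), S.card ≤ 0 ∧
      ¬ ∃ x ∈ box 3 (n), ∃ y ∈ innerBoundary (zdGraph 3) (box 3 (2 * n)),
        (ω \ (↑S : Set (Sym2 (Site 3)))) ∈ openConnIn (↑(box 3 (2 * n)) : Set (Site 3)) x y} ⊆
      {ω : BondConfig (Site 3) | ∃ x ∈ box 3 n,
        ∃ y ∈ innerBoundary (zdGraph 3) (box 3 (2 * n)), ω ∈ openConnIn ↑(box 3 (2 * n)) x y}ᶜ := by
    rintro ω ⟨S, hS, hno⟩ hX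
    have hS0 : S = ∅ := Finset.card_eq_zero.1 (Nat.le_zero.1 hS)
    subst hS0
    apply hno
    have he : ω \ ((↑(∅ : Finset (Sym2 (Site 3)))) : Set (Sym2 (Site 3))) = ω := by simp
    rw [he]
    exact hX
  have h1 := lt_of_lt_of_le hpos (measureReal_mono hsub)
  rw [probReal_compl_eq_one_sub (annulusAspect_measurableSet_crossing n (2 * n))] at h1
  linarith

/-! ### The X_B crossing misses the shell event of `B(2n) ∖ B(n)` -/

/-- On lattice configurations the X_B crossing event at scale `n ≥ 1` is disjoint from the shell event
`Shell(B(n), B(2n))` (last exit from `B(n)`: landed `annulusWalls_crossing`), hence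
`P(X_B(n)) ≤ 1 - P(Shell(B(n), B(2n)))`. -/
theorem annulusAspect_real_crossing_le_one_sub_shell (n : ℕ) (hn : 1 ≤ n) :
    (bondPercolation (zdGraph 3) (criticalProbI 3)).real {ω : BondConfig (Site 3) | ∃ x ∈ box 3 n,
        ∃ y ∈ innerBoundary (zdGraph 3) (box 3 (2 * n)), ω ∈ openConnIn ↑(box 3 (2 * n)) x y} ≤
      1 - (bondPercolation (zdGraph 3) (criticalProbI 3)).real
        {ω | ∀ u ∈ Set.Icc (fun _ : Fin 3 => -(2 * (n : ℤ))) (fun _ : Fin 3 => 2 * (n : ℤ)) \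
              Set.Icc (fun _ : Fin 3 => -(n : ℤ)) (fun _ : Fin 3 => (n : ℤ)),
          ∀ w ∈ Set.Icc (fun _ : Fin 3 => -(2 * (n : ℤ))) (fun _ : Fin 3 => 2 * (n : ℤ)) \
              Set.Icc (fun _ : Fin 3 => -(n : ℤ)) (fun _ : Fin 3 => (n : ℤ)),
            (∃ z ∈ Set.Icc (fun _ : Fin 3 => -(n : ℤ)) (fun _ : Fin 3 => (n : ℤ)), (zdGraph 3).Adj u z) →
            (∃ z ∉ Set.Icc (fun _ : Fin 3 => -(2 * (n : ℤ))) (fun _ : Fin 3 => 2 * (n : ℤ)),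
              (zdGraph 3).Adj w z) →
            ω ∉ openConnIn (Set.Icc (fun _ : Fin 3 => -(2 * (n : ℤ))) (fun _ : Fin 3 => 2 * (n : ℤ)) \
              Set.Icc (fun _ : Fin 3 => -(n : ℤ)) (fun _ : Fin 3 => (n : ℤ))) u w} := by
  rw [← probReal_compl_eq_one_sub (shellDecoupling_measurableSet_shell (zdGraph 3) _ _)]
  refine sixWalls_real_mono_of_subset_edgeSet (zdGraph 3) (criticalProbI 3) fun ω hω hX => ?_
  obtain ⟨x, hx, y, hy, hconn⟩ := hX
  obtain ⟨u, hu, w, hw, huz, hwz, huw⟩ := annulusWalls_crossing hn hω hx hy hconn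
  intro hShell
  exact hShell u hu w hw huz hwz huw

/-! ### The large-scale case: tiles `(m, 4m)` on the grid `(2m+1)·B(4)` -/

/-- **Large scales.** If `P(A(m, 4m)) ≤ 1 - c₄` for all `m ≥ 1` (`0 ≤ c₄ ≤ 1`), then for `n ≥ 7`:
`P(X_B(n)) ≤ 1 - c₄ ^ 9³` (tiled shell with tiles `(m, 4m)`, `m = ⌊(n-2)/5⌋`, grid `(2m+1)·B(4)`). -/
theorem annulusAspect_real_crossing_le_of_ge (c₄ : ℝ) (hc₀ : 0 ≤ c₄) (hc₁ : c₄ ≤ 1)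
    (h4 : ∀ m : ℕ, 1 ≤ m →
      (bondPercolation (zdGraph 3) (criticalProbI 3)).real
          {ω | ∃ x ∈ box 3 m, ∃ y ∈ innerBoundary (zdGraph 3) (box 3 (4 * m)),
            ω ∈ openConnIn ↑(box 3 (4 * m)) x y} ≤ 1 - c₄)
    (n : ℕ) (hn : 7 ≤ n) :
    (bondPercolation (zdGraph 3) (criticalProbI 3)).real {ω : BondConfig (Site 3) | ∃ x ∈ box 3 n,
        ∃ y ∈ innerBoundary (zdGraph 3) (box 3 (2 * n)), ω ∈ openConnIn ↑(box 3 (2 * n)) x y} ≤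
      1 - c₄ ^ (9 ^ 3) := by
  -- the objects
  set m : ℕ := (n - 2) / 5 with hm
  have hm1 : 1 ≤ m := by omega
  have hmn : 5 * (m : ℤ) + 2 ≤ (n : ℤ) ∧ (n : ℤ) ≤ 5 * (m : ℤ) + 6 := by omega
  set R : Set (Site 3) := Set.Icc (fun _ : Fin 3 => -(n : ℤ)) (fun _ : Fin 3 => (n : ℤ)) with hR
  set R' : Set (Site 3) :=
    Set.Icc (fun _ : Fin 3 => -(2 * (n : ℤ))) (fun _ : Fin 3 => 2 * (n : ℤ)) with hR'
  set g : ℤ := 2 * (m : ℤ) + 1 with hg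
  have hgpos : 0 < g := by omega
  set F : Site 3 → Site 3 := fun j i => g * j i with hF
  set J : Finset (Site 3) := (box 3 4).image F with hJ_def
  have hJcard : J.card ≤ 9 ^ 3 :=
    le_trans Finset.card_image_le (by rw [card_box])
  -- the cover: every vertex adjacent to `B(n)` lies in a tile whose `B(4m)`-neighbourhood is inside `B(2n)`
  have hcover : ∀ u ∈ R' \ R, (∃ z ∈ R, (zdGraph 3).Adj u z) →
      ∃ v ∈ J, u - v ∈ box 3 m ∧
        ∀ y : Site 3, y - v ∈ box 3 (4 * m) → ∀ z : Site 3, (zdGraph 3).Adj y z → z ∈ R' := by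
    rintro u - ⟨z₀, hz₀, huz₀⟩
    rw [hR, annulusAspect_mem_Icc] at hz₀
    have hb0 := zdGraph_adj_apply_le huz₀ 0
    have hb1 := zdGraph_adj_apply_le huz₀ 1
    have hb2 := zdGraph_adj_apply_le huz₀ 2
    have hz0 := hz₀ 0
    have hz1 := hz₀ 1
    have hz2 := hz₀ 2
    -- the tile index of `u`
    set q : Site 3 := fun i => (u i + m) / g with hq
    have hdiv : ∀ i, (u i + m) % g + g * q i = u i + m ∧
        0 ≤ (u i + m) % g ∧ (u i + m) % g < g := fun i =>
      ⟨Int.emod_add_mul_ediv _ _, Int.emod_nonneg _ hgpos.ne', Int.emod_lt_of_pos _ hgpos⟩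
    -- a priori bounds on `u`
    have hlo : ∀ i, -((n : ℤ) + 1) ≤ u i ∧ u i ≤ (n : ℤ) + 1 := by
      intro i
      fin_cases i <;> simp only [Fin.zero_eta, Fin.mk_one, Fin.reduceFinMk, Fin.isValue] <;> omega
    refine ⟨F q, ?_, ?_, ?_⟩
    · -- `F q ∈ J`
      rw [hJ_def, Finset.mem_image]
      refine ⟨q, ?_, rfl⟩
      rw [mem_box]
      intro i
      obtain ⟨he, h0, h1⟩ := hdiv i
      obtain ⟨hl, hu⟩ := hlo i
      constructor
      · by_contra hlt
        push Not at hlt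
        have hm' : g * q i ≤ g * (-5) := mul_le_mul_of_nonneg_left (by omega) hgpos.le
        generalize g * q i = X at he hm'
        generalize (u i + m) % g = Y at he h0 h1
        push_cast at hlt he hm' h0 h1 hl hu
        omega
      · by_contra hlt
        push Not at hlt
        have hm' : g * 5 ≤ g * q i := mul_le_mul_of_nonneg_left (by omega) hgpos.le
        generalize g * q i = X at he hm'
        generalize (u i + m) % g = Y at he h0 h1
        push_cast at hlt he hm' h0 h1 hl hu
        omega
    · -- `u - F q ∈ B(m)`
      rw [mem_box]
      intro i
      obtain ⟨he, h0, h1⟩ := hdiv i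
      change -(m : ℤ) ≤ u i - g * q i ∧ u i - g * q i ≤ (m : ℤ)
      generalize g * q i = X at he ⊢
      generalize (u i + m) % g = Y at he h0 h1
      omega
    · -- room: neighbours of `F q + B(4m)` lie in `R'`
      intro y hy z hyz
      rw [mem_box] at hy
      rw [hR', annulusAspect_mem_Icc]
      have hy0 := hy 0
      have hy1 := hy 1
      have hy2 := hy 2
      change -((4 * m : ℕ) : ℤ) ≤ y 0 - g * q 0 ∧ y 0 - g * q 0 ≤ ((4 * m : ℕ) : ℤ) at hy0
      change -((4 * m : ℕ) : ℤ) ≤ y 1 - g * q 1 ∧ y 1 - g * q 1 ≤ ((4 * m : ℕ) : ℤ) at hy1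
      change -((4 * m : ℕ) : ℤ) ≤ y 2 - g * q 2 ∧ y 2 - g * q 2 ≤ ((4 * m : ℕ) : ℤ) at hy2
      have hz0' := zdGraph_adj_apply_le hyz 0
      have hz1' := zdGraph_adj_apply_le hyz 1
      have hz2' := zdGraph_adj_apply_le hyz 2
      obtain ⟨he0, h00, h10⟩ := hdiv 0
      obtain ⟨he1, h01, h11⟩ := hdiv 1
      obtain ⟨he2, h02, h12⟩ := hdiv 2
      obtain ⟨hl0, hu0⟩ := hlo 0
      obtain ⟨hl1, hu1⟩ := hlo 1
      obtain ⟨hl2, hu2⟩ := hlo 2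
      generalize g * q 0 = X0 at he0 hy0
      generalize g * q 1 = X1 at he1 hy1
      generalize g * q 2 = X2 at he2 hy2
      generalize (u 0 + m) % g = Y0 at he0 h00 h10
      generalize (u 1 + m) % g = Y1 at he1 h01 h11
      generalize (u 2 + m) % g = Y2 at he2 h02 h12
      push_cast at hy0 hy1 hy2
      intro i
      fin_cases i <;> simp only [Fin.zero_eta, Fin.mk_one, Fin.reduceFinMk, Fin.isValue] <;> omega
  -- T1': the tiled shell has probability ≥ c₄ ^ |J| ≥ c₄ ^ 9³
  have hm4 : m ≤ 4 * m := by omega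
  have hT := stub_tiledShellAspect (criticalProbI 3) hm4 c₄ hc₀ (h4 m hm1) R R' J hcover
  have hShell := le_trans (pow_le_pow_of_le_one hc₀ hc₁ hJcard) hT
  have hX := annulusAspect_real_crossing_le_one_sub_shell n (by omega)
  rw [hR, hR'] at hShell
  linarith

/-! ### The stub -/

/-- **X4 — the aspect ratio of X_B is immaterial** (registered link stub of line `Sketch`, rev c3).
X_B at aspect `4` (`P_{p_c}(B(n) ↔ ∂ⁱⁿB(4n) inside B(4n)) ≤ 1 - c₄` for all `n ≥ 1`) implies
`PercAnnulusCrossing.CritAnnulusNonCrossing` verbatim (aspect `2`), with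
`c = min c' (c₄ ^ 9³)`, `c'` a finite-energy constant for `n ≤ 6`. -/
theorem stub_annulusNonCrossing_of_aspectFour
    (h4 : ∃ c : ℝ, 0 < c ∧ ∀ n : ℕ, 1 ≤ n →
      (bondPercolation (zdGraph 3) (criticalProbI 3)).real
          {ω | ∃ x ∈ box 3 n, ∃ y ∈ innerBoundary (zdGraph 3) (box 3 (4 * n)),
            ω ∈ openConnIn ↑(box 3 (4 * n)) x y} ≤ 1 - c) :
    ∃ c : ℝ, 0 < c ∧ ∀ n : ℕ, 1 ≤ n →
      (bondPercolation (zdGraph 3) (criticalProbI 3)).real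
          {ω | ∃ x ∈ box 3 n, ∃ y ∈ innerBoundary (zdGraph 3) (box 3 (2 * n)),
            ω ∈ openConnIn ↑(box 3 (2 * n)) x y} ≤ 1 - c := by
  obtain ⟨c₄, hc₄, h4⟩ := h4
  have hc₁ : c₄ ≤ 1 := by
    have h := h4 1 le_rfl
    linarith [(measureReal_nonneg :
      0 ≤ (bondPercolation (zdGraph 3) (criticalProbI 3)).real
        {ω | ∃ x ∈ box 3 1, ∃ y ∈ innerBoundary (zdGraph 3) (box 3 (4 * 1)),
          ω ∈ openConnIn ↑(box 3 (4 * 1)) x y})]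
  -- small scales: finite energy
  obtain ⟨c', hc', hsmall⟩ := PinholeClosing.Negative.exists_pos_lower_bound
    (fun n => 1 - (bondPercolation (zdGraph 3) (criticalProbI 3)).real {ω : BondConfig (Site 3) |
      ∃ x ∈ box 3 n, ∃ y ∈ innerBoundary (zdGraph 3) (box 3 (2 * n)),
        ω ∈ openConnIn ↑(box 3 (2 * n)) x y})
    (fun n hn => by linarith [annulusAspect_real_crossing_lt_one n hn]) 7
  refine ⟨min c' (c₄ ^ (9 ^ 3)), lt_min hc' (by positivity), fun n hn => ?_⟩
  by_cases h7 : n < 7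
  · have h := hsmall n hn h7
    linarith [min_le_left c' (c₄ ^ (9 ^ 3))]
  · have h := annulusAspect_real_crossing_le_of_ge c₄ hc₄.le hc₁ h4 n (by omega)
    linarith [min_le_right c' (c₄ ^ (9 ^ 3))]

/-- **X_B at aspect 4 ⇒ X_B** by name (`PercAnnulusCrossing.CritAnnulusNonCrossing`,
stmt-CriticalPhenomena-0846): the sibling crux may be attacked at aspect `4`. -/
theorem critAnnulusNonCrossing_of_aspectFour
    (h4 : ∃ c : ℝ, 0 < c ∧ ∀ n : ℕ, 1 ≤ n →
      (bondPercolation (zdGraph 3) (criticalProbI 3)).real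
          {ω | ∃ x ∈ box 3 n, ∃ y ∈ innerBoundary (zdGraph 3) (box 3 (4 * n)),
            ω ∈ openConnIn ↑(box 3 (4 * n)) x y} ≤ 1 - c) :
    Theses.PercAnnulusCrossing.CritAnnulusNonCrossing :=
  stub_annulusNonCrossing_of_aspectFour h4

/-- The converse is pointwise: on lattice configurations an aspect-4 crossing clips, at its first
visit to `∂ⁱⁿB(2n)`, to an aspect-2 crossing (landed `PinholeClosing.Negative.exists_crossing_of_crossing`),
so X_B implies X_B at aspect `4` with the same constant. -/
theorem annulusNonCrossingFour_of_critAnnulusNonCrossing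
    (h2 : Theses.PercAnnulusCrossing.CritAnnulusNonCrossing) :
    ∃ c : ℝ, 0 < c ∧ ∀ n : ℕ, 1 ≤ n →
      (bondPercolation (zdGraph 3) (criticalProbI 3)).real
          {ω | ∃ x ∈ box 3 n, ∃ y ∈ innerBoundary (zdGraph 3) (box 3 (4 * n)),
            ω ∈ openConnIn ↑(box 3 (4 * n)) x y} ≤ 1 - c := by
  obtain ⟨c, hc, h⟩ := h2
  refine ⟨c, hc, fun n hn => le_trans ?_ (h n hn)⟩
  refine PinholeClosing.Negative.real_mono_of_lattice fun ω hω hA => ?_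
  obtain ⟨x, hx, y, hy, hxy⟩ := hA
  obtain ⟨z, hz, hxz⟩ := PinholeClosing.Negative.exists_crossing_of_crossing
    (M := 2 * n) (M' := 4 * n) (by omega) hω (box_mono 3 (by omega : n ≤ 2 * n) hx) hy hxy
  exact ⟨x, hx, z, hz, hxz⟩

/-- **Aspect equivalence of X_B**: `CritAnnulusNonCrossing` (aspect `2`) holds iff its aspect-`4` form does. -/
theorem critAnnulusNonCrossing_iff_aspectFour :
    Theses.PercAnnulusCrossing.CritAnnulusNonCrossing ↔
      ∃ c : ℝ, 0 < c ∧ ∀ n : ℕ, 1 ≤ n →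
        (bondPercolation (zdGraph 3) (criticalProbI 3)).real
            {ω | ∃ x ∈ box 3 n, ∃ y ∈ innerBoundary (zdGraph 3) (box 3 (4 * n)),
              ω ∈ openConnIn ↑(box 3 (4 * n)) x y} ≤ 1 - c :=
  ⟨annulusNonCrossingFour_of_critAnnulusNonCrossing, critAnnulusNonCrossing_of_aspectFour⟩

end Summit.CriticalPhenomena.PercolationContinuityZ3.Theorems.TetrahedronDisjointCoexistence

end
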